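import Summits.BirchSwinnertonDyer.Rank1Residual.X10.ClassX10bLeaf
import Summits.BirchSwinnertonDyer.BirchSwinnertonDyer.Theorems.SmallImageMuTransferMuTransferStubCm
import Literature.NumberTheory.EllipticCurves.Rank1Residual.X9TrivialPartner
import Literature.NumberTheory.EllipticCurves.EmertonPollackWeston2006.MuAnTransferGoodOrdinary
import Literature.NumberTheory.EllipticCurves.GreenbergVatsal2000.CongruentCurves
import HarnessLib

/-!
# Class X10b = N2 (`p = 3` good ordinary, `E[3]` irreducible, `ρ̄_{E,3}` NOT surjective): the analytic
# `μ = 0` certificate at `3` is a `ρ̄`-INVARIANT — one certificate per mod-`3` congruence class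
# (the `p = 3` twin of `SmallImageMuTransferAnalyticMuZeroX9RhoBarInvariance`; K6 judge note (d))

HONEST FRAMING (run/shared/lean/b2b/bsd-rank1-residual/, verbatim in every file): the goal of the
cell is to DELETE the COMBINATION-SHAPED residual classes of the Birch–Swinnerton-Dyer formula for
ALL analytic-rank `≤ 1` elliptic curves over `ℚ` — assembled STRICTLY from published theorems — so
that the rank-`≤ 1` remainder becomes exactly the CONSTRUCTION-SHAPED classes, which are TYPED, NOT
attempted. This is not "finishing BSD". Cell `b2b-bsdres`, unit `b2b-bsdres-x10` = N2 class lead,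
GEN 37. Theorems only, conditional on named PUBLISHED facts taken as explicit binders; nothing is
booked; X10b keeps its label CONSTRUCTION-SHAPED / NEEDS X_A3; no census number moves.

## What (X10-AUDIT §42.4 → §43)

`AnalyticMuZeroOnClassX10b` (x10 GEN 35, `X10/ClassX10bLeaf`) — Greenberg's `μ = 0` on the ANALYTIC
side at `3` on class X10b, the programme's barrier B3 at `3` — is OPEN as a class statement and
certified per pair (313/313 census cells, three engines, x10 GEN 36). The K6 tribunal judge's note (d)
for the X9 twin: "per-`ρ̄` deletions bankable, the class-wide item never closes that way"; the cell
`bsd-smallim` put the per-`ρ̄` clause in the kernel for X9 (`certificate_of_torsionIso`,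
`analyticCertificate_classX9_of_torsionIso`, seat koly gen 6) from Emerton–Pollack–Weston 2006 Thm. 1
— whose tree transcription `EmertonPollackWeston2006.thm1_muAn_transfer_of_torsionIso` carries `5 ≤ p`.
x10 GEN 36 AUDITED the print (X10-AUDIT §42.4): EPW "fix an odd prime `p`" (§1 Notation, arXiv p. 5)
and require `ρ̄` irreducible, odd, `p`-ordinary and `p`-DISTINGUISHED (§2.6: the two characters of
`ρ̄|_{G_p}` distinct) — which HOLDS for an elliptic curve good ordinary at ANY odd `p` (on inertia the
two diagonal characters are `ω` and `1`, and `ω|_{I_p} ≠ 1` for `p ≥ 3`); nowhere `p ≥ 5`. So: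

* `thm1_muAn_transfer_of_torsionIso_odd` — the SAME named fact with `5 ≤ p` replaced by `p ≠ 2`
  (cite-tagged; stated inline here for relocation next to its `5 ≤ p` sibling; nothing asserted), and
  `thm1_muAn_transfer_of_torsionIso_of_odd` — it implies the landed `5 ≤ p` transcription;
* `certificate_three_of_torsionIso` — **the crux-shaped certificate "some coefficient of `L_p(f, α_W)`
  is a `p`-adic unit" is a `ρ̄`-invariant at every ODD good ordinary `p` with `E[p]` irreducible**
  (koly's `certificate_of_torsionIso` with `5 ≤ p ↦ p ≠ 2`: the period ratio is a `p`-adic unit at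
  every odd `p` by `norm_periodRatio_eq_one_of_odd`, i.e. Greenberg–Vatsal Rem. 3.4 + Mazur's Manin
  constant at `3 ∤ N`, tree facts `h5`/`h3`);
* `analyticCertificate_classX10b_of_torsionIso` — **on class X10b the analytic `μ = 0` input is decided
  congruence class by congruence class**: for two X10b pairs with `Γ_ℚ`-isomorphic `E[3]`, the
  certificate for every newform of one gives it for every newform of the other. Since EPW's `H(ρ̄)`
  contains the weight-2 newform of EVERY good-ordinary-at-`3` curve with that `ρ̄`, each of the census's
  certified `ρ̄` (313 cells) deletes B3 at `3` on an INFINITE family of X10b pairs — modulo the cited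
  facts (`hEPW`, `h5`, `h3`, Carayol `hlev`, modularity `hmodP`).

What this is NOT: not a proof of any `μ = 0`; not a booking; EPW's theorem is cited, not proved; the
class statement `AnalyticMuZeroOnClassX10b` stays OPEN (infinitely many `ρ̄`).

References: [EmertonPollackWeston2006] Thm. 1 (p. 2), §1 Notation (p. 5), §2.6; [GreenbergVatsal2000]
§3 Rem. (3.4), Prop. (3.7); [Mazur1978] Cor. 4.1; X10-AUDIT §42.4, §43.
-/

set_option autoImplicit false

noncomputable section

open scoped Classical MatrixGroups ModularForm
open CongruenceSubgroup WeierstrassCurve Field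
open Literature.NumberTheory.EllipticCurves Literature.NumberTheory.EllipticCurves.ModularForms
open Literature.NumberTheory.EllipticCurves.Rank1Residual
open Summit.BirchSwinnertonDyer.BirchSwinnertonDyer.Rank1Residual (exists_norm_coeff_eq_one_of_isNewformOf)

namespace Summit.BirchSwinnertonDyer.Rank1Residual.X10

/-- **Emerton–Pollack–Weston 2006, Theorem 1 (analytic half), for two elliptic curves good ordinary
at an ODD prime `p` with isomorphic irreducible `p`-torsion.** M. Emerton, R. Pollack, T. Weston,
*Variation of Iwasawa invariants in Hida families*, Invent. Math. 163 (2006) 523–580 =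
arXiv:math/0404484, Theorem 1 (p. 2): "Fix `∗ ∈ {alg, an}`. If `μ^∗(f₀) = 0` for some `f₀ ∈ H(ρ̄)`,
then `μ^∗(f) = 0` for all `f ∈ H(ρ̄)`", for "`ρ̄ : G_ℚ → GL₂(k)` an absolutely irreducible modular
Galois representation over a finite field `k` of characteristic `p` … `p`-ordinary and
`p`-distinguished", with "We fix an odd prime `p`" (§1, Notation, p. 5) and `p`-distinguished = "the
characters `χ` and `ψ` [of the ordinary filtration at `p`] are distinct" (§2.6). TRANSCRIPTION
(`∗ = an`): VERBATIM the tree's `EmertonPollackWeston2006.thm1_muAn_transfer_of_torsionIso` with its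
`5 ≤ p` replaced by `p ≠ 2` — for a globally minimal elliptic curve good ORDINARY at an odd `p` the
residual representation is `p`-distinguished at every odd `p` (on the inertia group at `p` the two
diagonal characters are `ω` and `1`, and `ω ≠ 1` there since `p − 1 ≥ 2`), absolutely irreducible
(irreducible and odd), modular; HYPOTHESIS "`μ^an(f₁) = 0`" and CONCLUSION "`μ^an(f₂) = 0`" in the
cell's Néron normalisation (some coefficient of `ϖ·L_p(f, α)`, `ϖ·Ω_W = Ω⁺_f`, is a `p`-adic unit;
EPW's canonical-period `μ^an` agrees with it for irreducible `E[p]` by Greenberg–Vatsal 2000 §3,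
Prop. (3.7) printed for odd `p`). Weaker than print (two weight-2 members of `H(ρ̄)` only), never
stronger. Named fact; nothing asserted; users take `(h : thm1_muAn_transfer_of_torsionIso_odd)`.
-- TODO(general form): Theorem 1 for every pair of members of H(ρ̄) (all weights, tame levels), and ∗ = alg.
[cite: EmertonPollackWeston2006, Thm. 1 (arXiv:math/0404484 p. 2), §1 Notation (p. 5 "We fix an odd prime p"), §2.6 (p-distinguished), Prop. 4.1.4]
[cite: GreenbergVatsal2000, §3, Prop. (3.1), Remark (3.4), Prop. (3.7)]
[file NumberTheory/EllipticCurves/EmertonPollackWeston2006/MuAnTransferGoodOrdinary] -/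
def thm1_muAn_transfer_of_torsionIso_odd : Prop :=
  ∀ (W₁ W₂ : WeierstrassCurve ℚ) [W₁.IsElliptic] [W₁.IsGloballyMinimal]
    [W₂.IsElliptic] [W₂.IsGloballyMinimal] (p : ℕ) [Fact p.Prime],
    p ≠ 2 →
    W₁.HasGoodReductionAtPrime p → ¬ (p : ℤ) ∣ W₁.frobeniusTrace p →
    W₂.HasGoodReductionAtPrime p → ¬ (p : ℤ) ∣ W₂.frobeniusTrace p →
    (∃ e : geomTorsion W₁ (p : ℤ) ≃+ geomTorsion W₂ (p : ℤ),
      ∀ (σ : Field.absoluteGaloisGroup ℚ) (P : geomTorsion W₁ (p : ℤ)), e (σ • P) = σ • e P) →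
    W₁.HasIrreducibleModPGaloisRep p →
    (∀ [NeZero (W₁.conductorNorm ℤ)] (f₁ : CuspForm (Gamma0 (W₁.conductorNorm ℤ)) 2),
        IsNewformOf W₁ f₁ → ∀ (ϖ₁ : ℚ), (ϖ₁ : ℝ) * W₁.realPeriodRat = plusPeriod f₁ →
      ∃ n : ℕ, ‖PowerSeries.coeff n
        (PowerSeries.C (ϖ₁ : ℚ_[p]) * padicLFunction f₁ (unitRoot W₁ p : ℚ_[p]))‖ = 1) →
    ∀ [NeZero (W₂.conductorNorm ℤ)] (f₂ : CuspForm (Gamma0 (W₂.conductorNorm ℤ)) 2),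
        IsNewformOf W₂ f₂ → ∀ (ϖ₂ : ℚ), (ϖ₂ : ℝ) * W₂.realPeriodRat = plusPeriod f₂ →
      ∃ n : ℕ, ‖PowerSeries.coeff n
        (PowerSeries.C (ϖ₂ : ℚ_[p]) * padicLFunction f₂ (unitRoot W₂ p : ℚ_[p]))‖ = 1

/-- The odd-prime transcription implies the landed `5 ≤ p` one (bookkeeping).
[cite: EmertonPollackWeston2006, Thm. 1 (arXiv:math/0404484 p. 2)] -/
theorem thm1_muAn_transfer_of_torsionIso_of_odd (h : thm1_muAn_transfer_of_torsionIso_odd) :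
    EmertonPollackWeston2006.thm1_muAn_transfer_of_torsionIso := by
  intro W₁ W₂ _ _ _ _ p _ hp5
  exact h W₁ W₂ p (by omega)

/-- **The crux certificate is a `ρ̄`-invariant at every ODD good ordinary prime with `E[p]`
irreducible, modulo Emerton–Pollack–Weston Thm. 1 (odd `p`), the period units and Carayol.** For
globally minimal `W, W'` over `ℚ`, `p ≠ 2` good ordinary for both, `W[p]` irreducible, a
`Γ_ℚ`-equivariant `W[p] ≃ W'[p]`, newforms `f` of `W` and `f'` of `W'` (any levels): a unit
coefficient of `L_p(f, α_W)` gives a unit coefficient of `L_p(f', α_{W'})`. The `p ≠ 2` form of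
`certificate_of_torsionIso` (cell `bsd-smallim`), the period ratio being a `p`-adic unit at every odd
`p` (`norm_periodRatio_eq_one_of_odd`: `h5` at `p ≥ 5`, `h3` at `p = 3`).
[cite: EmertonPollackWeston2006, Thm. 1 (arXiv:math/0404484 p. 2)] [cite: GreenbergVatsal2000, §3 Remark (3.4)] -/
theorem certificate_of_torsionIso_of_ne_two
    (hEPW : thm1_muAn_transfer_of_torsionIso_odd)
    (h5 : realPeriodRat_eq_unit_mul_plusPeriod) (h3 : realPeriodRat_eq_unit_mul_plusPeriod_three)
    (hlev : ∀ (N : ℕ) [NeZero N], IsNewformOf.level_eq_conductorNorm (N := N))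
    (W W' : WeierstrassCurve ℚ) [W.IsElliptic] [W.IsGloballyMinimal] [W'.IsElliptic]
    [W'.IsGloballyMinimal] (p : ℕ) [Fact p.Prime] (hp : p ≠ 2)
    (hgood : W.HasGoodReductionAtPrime p) (hord : ¬ (p : ℤ) ∣ W.frobeniusTrace p)
    (hirr : W.HasIrreducibleModPGaloisRep p)
    (hgood' : W'.HasGoodReductionAtPrime p) (hord' : ¬ (p : ℤ) ∣ W'.frobeniusTrace p)
    (hiso : ∃ e : geomTorsion W (p : ℤ) ≃+ geomTorsion W' (p : ℤ),
      ∀ (σ : Field.absoluteGaloisGroup ℚ) (P : geomTorsion W (p : ℤ)), e (σ • P) = σ • e P)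
    {N : ℕ} [NeZero N] (f : CuspForm (Gamma0 N) 2) (hf : IsNewformOf W f)
    {N' : ℕ} [NeZero N'] (f' : CuspForm (Gamma0 N') 2) (hf' : IsNewformOf W' f')
    (hcert : ∃ n : ℕ, ‖PowerSeries.coeff n (padicLFunction f (unitRoot W p : ℚ_[p]))‖ = 1) :
    ∃ n : ℕ, ‖PowerSeries.coeff n (padicLFunction f' (unitRoot W' p : ℚ_[p]))‖ = 1 := by
  -- irreducibility of `W'[p]`, transported along the isomorphism
  obtain ⟨e, he⟩ := hiso
  have hirr' : W'.HasIrreducibleModPGaloisRep p :=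
    GreenbergVatsal2000.hasIrreducibleModPGaloisRep_of_torsionIso e he hirr
  -- the certificate of `W` in the Néron shape (`‖ϖ₁‖_p = 1`, newform uniqueness), moved to `W'` by EPW
  have hμW : ∀ [NeZero (W.conductorNorm ℤ)] (f₁ : CuspForm (Gamma0 (W.conductorNorm ℤ)) 2),
      IsNewformOf W f₁ → ∀ (ϖ₁ : ℚ), (ϖ₁ : ℝ) * W.realPeriodRat = plusPeriod f₁ →
      ∃ n : ℕ, ‖PowerSeries.coeff n
        (PowerSeries.C (ϖ₁ : ℚ_[p]) * padicLFunction f₁ (unitRoot W p : ℚ_[p]))‖ = 1 := by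
    intro _ f₁ hf₁ ϖ₁ hϖ₁
    have hϖ₁norm : ‖(ϖ₁ : ℚ_[p])‖ = 1 :=
      norm_periodRatio_eq_one_of_odd h5 h3 W p hp hgood hirr f₁ hf₁ ϖ₁ hϖ₁
    obtain ⟨n, hn⟩ := exists_norm_coeff_eq_one_of_isNewformOf hlev hf₁ hf _ hcert
    exact ⟨n, by rw [PowerSeries.coeff_C_mul, norm_mul, hϖ₁norm, one_mul, hn]⟩
  -- read it on `f'` at level `N_{W'}` (Carayol) with the period ratio `ϖ' = u⁻¹`
  obtain rfl : N' = W'.conductorNorm ℤ := hlev N' hf'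
  have hμW' := hEPW W W' p hp hgood hord hgood' hord' ⟨e, he⟩ hirr
    (fun f₁ hf₁ ϖ₁ hϖ₁ => hμW f₁ hf₁ ϖ₁ hϖ₁)
  -- `Ω_{W'} = u · Ω⁺_{f'}` with `‖u‖_p = 1` at `p = 3` and at `p ≥ 5`
  have hu : ∃ u : ℚ, ‖(u : ℚ_[p])‖ = 1 ∧ W'.realPeriodRat = u * plusPeriod f' := by
    by_cases hp3 : p = 3
    · subst hp3
      exact h3 W' hgood' hirr' f' hf'
    · exact h5 W' p ((Fact.out : p.Prime).five_le_of_ne_two_of_ne_three hp hp3) hgood' hirr' f' hf'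
  obtain ⟨u, hu1, hu⟩ := hu
  have hu0 : u ≠ 0 := by
    rintro rfl
    simp at hu1
  have hϖ : ((u⁻¹ : ℚ) : ℝ) * W'.realPeriodRat = plusPeriod f' := by
    rw [hu]
    push_cast
    field_simp
  have hϖnorm : ‖((u⁻¹ : ℚ) : ℚ_[p])‖ = 1 :=
    norm_periodRatio_eq_one_of_odd h5 h3 W' p hp hgood' hirr' f' hf' u⁻¹ hϖ
  obtain ⟨n, hn⟩ := hμW' f' hf' u⁻¹ hϖ
  refine ⟨n, ?_⟩
  rw [PowerSeries.coeff_C_mul, norm_mul, hϖnorm, one_mul] at hn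
  exact hn

/-- **On class X10b = N2 the analytic `μ = 0` input at `3` is decided per mod-`3` congruence class.**
For two X10b pairs `(W, p)`, `(W', p)` (`ClassX10 W p ∧ ¬ Surj W 3`, so `p = 3`, good ordinary,
`E[3]` irreducible, `ρ̄_{E,3}` not surjective) with a `Γ_ℚ`-equivariant `W[3] ≃ W'[3]`: if every newform
of `W` carries the unit-coefficient certificate (the conclusion of `AnalyticMuZeroOnClassX10b` at
`(W, 3)`), so does every newform of `W'` — modulo EPW Thm. 1 at odd `p` (`hEPW`), the period units
(`h5`, `h3`), Carayol (`hlev`) and modularity (`hmodP`). One exact modular-symbol certificate per `ρ̄`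
serves the whole congruence class ∩ X10b (K6 judge note (d), now at `p = 3`); the census's 313 certified
cells (x10 GEN 36, `class-closure/N2/MUCERT3-x10g36.tsv`) thus each delete barrier B3 at `3` on an
infinite family. [cite: EmertonPollackWeston2006, Thm. 1 (arXiv:math/0404484 p. 2)]
[cite: GreenbergLNM1716, §1 Conj. 1.11] -/
theorem analyticCertificate_classX10b_of_torsionIso
    (hEPW : thm1_muAn_transfer_of_torsionIso_odd)
    (h5 : realPeriodRat_eq_unit_mul_plusPeriod) (h3 : realPeriodRat_eq_unit_mul_plusPeriod_three)
    (hlev : ∀ (N : ℕ) [NeZero N], IsNewformOf.level_eq_conductorNorm (N := N))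
    (hmodP : nonempty_modularParametrizationData)
    (W W' : WeierstrassCurve ℚ) [W.IsElliptic] [W.IsGloballyMinimal] [W'.IsElliptic]
    [W'.IsGloballyMinimal] (p : ℕ) [Fact p.Prime]
    (hX : ClassX10 W p) (hX' : ClassX10 W' p)
    (hiso : ∃ e : geomTorsion W (p : ℤ) ≃+ geomTorsion W' (p : ℤ),
      ∀ (σ : Field.absoluteGaloisGroup ℚ) (P : geomTorsion W (p : ℤ)), e (σ • P) = σ • e P)
    (hcert : ∀ {N : ℕ} [NeZero N] (f : CuspForm (Gamma0 N) 2), IsNewformOf W f →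
      ∃ n : ℕ, ‖PowerSeries.coeff n (padicLFunction f (unitRoot W p : ℚ_[p]))‖ = 1)
    {N' : ℕ} [NeZero N'] (f' : CuspForm (Gamma0 N') 2) (hf' : IsNewformOf W' f') :
    ∃ n : ℕ, ‖PowerSeries.coeff n (padicLFunction f' (unitRoot W' p : ℚ_[p]))‖ = 1 := by
  obtain ⟨hp3, ⟨hgood, hord⟩, hirr, -⟩ := hX
  obtain ⟨-, ⟨hgood', hord'⟩, -, -⟩ := hX'
  subst hp3
  -- a newform of `W` (modularity), at which the universal certificate is read
  haveI : NeZero (W.conductorNorm ℤ) := ⟨(W.conductorNorm_pos_holds).ne'⟩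
  obtain ⟨Dm⟩ := hmodP W
  exact certificate_of_torsionIso_of_ne_two hEPW h5 h3 hlev W W' 3 (by decide) hgood hord hirr
    hgood' hord' hiso Dm.f Dm.isNewformOf f' hf' (hcert Dm.f Dm.isNewformOf)


/-! ### Re-pointing to the Literature transcription (appended x10 GEN 37, after p442926)

The odd-prime transcription of EPW Thm. 1 now lives in the Literature file next to its `5 ≤ p` sibling:
`Literature.NumberTheory.EllipticCurves.EmertonPollackWeston2006.thm1_muAn_transfer_of_torsionIso_odd`
(p442926; same statement as this file's inline copy `thm1_muAn_transfer_of_torsionIso_odd` above, which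
stays only because landed declarations are append-only). Consumers should hold the LITERATURE fact; the
bridge and the primed theorems below serve them. -/

/-- The Literature transcription (canonical home, p442926) yields this file's inline copy of the same
statement (bridge; the two `Prop`s have identical bodies). [cite: EmertonPollackWeston2006, Thm. 1 (arXiv:math/0404484 p. 2)] -/
theorem thm1_muAn_transfer_of_torsionIso_odd_of_literature
    (h : EmertonPollackWeston2006.thm1_muAn_transfer_of_torsionIso_odd) :
    thm1_muAn_transfer_of_torsionIso_odd :=
  fun W₁ W₂ _ _ _ _ p _ => h W₁ W₂ p

/-- `certificate_of_torsionIso_of_ne_two` with the EPW input taken as the LITERATURE fact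
`EmertonPollackWeston2006.thm1_muAn_transfer_of_torsionIso_odd`. [cite: EmertonPollackWeston2006, Thm. 1 (arXiv:math/0404484 p. 2)]
[cite: GreenbergVatsal2000, §3 Remark (3.4)] -/
theorem certificate_of_torsionIso_of_ne_two'
    (hEPW : EmertonPollackWeston2006.thm1_muAn_transfer_of_torsionIso_odd)
    (h5 : realPeriodRat_eq_unit_mul_plusPeriod) (h3 : realPeriodRat_eq_unit_mul_plusPeriod_three)
    (hlev : ∀ (N : ℕ) [NeZero N], IsNewformOf.level_eq_conductorNorm (N := N))
    (W W' : WeierstrassCurve ℚ) [W.IsElliptic] [W.IsGloballyMinimal] [W'.IsElliptic]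
    [W'.IsGloballyMinimal] (p : ℕ) [Fact p.Prime] (hp : p ≠ 2)
    (hgood : W.HasGoodReductionAtPrime p) (hord : ¬ (p : ℤ) ∣ W.frobeniusTrace p)
    (hirr : W.HasIrreducibleModPGaloisRep p)
    (hgood' : W'.HasGoodReductionAtPrime p) (hord' : ¬ (p : ℤ) ∣ W'.frobeniusTrace p)
    (hiso : ∃ e : geomTorsion W (p : ℤ) ≃+ geomTorsion W' (p : ℤ),
      ∀ (σ : Field.absoluteGaloisGroup ℚ) (P : geomTorsion W (p : ℤ)), e (σ • P) = σ • e P)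
    {N : ℕ} [NeZero N] (f : CuspForm (Gamma0 N) 2) (hf : IsNewformOf W f)
    {N' : ℕ} [NeZero N'] (f' : CuspForm (Gamma0 N') 2) (hf' : IsNewformOf W' f')
    (hcert : ∃ n : ℕ, ‖PowerSeries.coeff n (padicLFunction f (unitRoot W p : ℚ_[p]))‖ = 1) :
    ∃ n : ℕ, ‖PowerSeries.coeff n (padicLFunction f' (unitRoot W' p : ℚ_[p]))‖ = 1 :=
  certificate_of_torsionIso_of_ne_two (thm1_muAn_transfer_of_torsionIso_odd_of_literature hEPW) h5 h3
    hlev W W' p hp hgood hord hirr hgood' hord' hiso f hf f' hf' hcert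

/-- `analyticCertificate_classX10b_of_torsionIso` with the EPW input taken as the LITERATURE fact
`EmertonPollackWeston2006.thm1_muAn_transfer_of_torsionIso_odd`: on class X10b = N2 the analytic
`μ = 0` input at `3` is decided per mod-`3` congruence class. [cite: EmertonPollackWeston2006, Thm. 1 (arXiv:math/0404484 p. 2)]
[cite: GreenbergLNM1716, §1 Conj. 1.11] -/
theorem analyticCertificate_classX10b_of_torsionIso'
    (hEPW : EmertonPollackWeston2006.thm1_muAn_transfer_of_torsionIso_odd)
    (h5 : realPeriodRat_eq_unit_mul_plusPeriod) (h3 : realPeriodRat_eq_unit_mul_plusPeriod_three)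
    (hlev : ∀ (N : ℕ) [NeZero N], IsNewformOf.level_eq_conductorNorm (N := N))
    (hmodP : nonempty_modularParametrizationData)
    (W W' : WeierstrassCurve ℚ) [W.IsElliptic] [W.IsGloballyMinimal] [W'.IsElliptic]
    [W'.IsGloballyMinimal] (p : ℕ) [Fact p.Prime]
    (hX : ClassX10 W p) (hX' : ClassX10 W' p)
    (hiso : ∃ e : geomTorsion W (p : ℤ) ≃+ geomTorsion W' (p : ℤ),
      ∀ (σ : Field.absoluteGaloisGroup ℚ) (P : geomTorsion W (p : ℤ)), e (σ • P) = σ • e P)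
    (hcert : ∀ {N : ℕ} [NeZero N] (f : CuspForm (Gamma0 N) 2), IsNewformOf W f →
      ∃ n : ℕ, ‖PowerSeries.coeff n (padicLFunction f (unitRoot W p : ℚ_[p]))‖ = 1)
    {N' : ℕ} [NeZero N'] (f' : CuspForm (Gamma0 N') 2) (hf' : IsNewformOf W' f') :
    ∃ n : ℕ, ‖PowerSeries.coeff n (padicLFunction f' (unitRoot W' p : ℚ_[p]))‖ = 1 :=
  analyticCertificate_classX10b_of_torsionIso (thm1_muAn_transfer_of_torsionIso_odd_of_literature hEPW)
    h5 h3 hlev hmodP W W' p hX hX' hiso hcert f' hf'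

end Summit.BirchSwinnertonDyer.Rank1Residual.X10

end
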